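import Literature.Topology.FourManifolds.MMSWFibreRotation
import Literature.Analysis.SpecialFunctions.SmoothTruncatedArg
import HarnessLib

/-!
# The membrane twist of the model `M_r`: spread-out twists `u(z)^k` versus twists at membranes

Sibling of `MMSWRasmussen.lean`, `MMSWRasmussenFiniteApproxProofs.lean` and
`MMSWFibreRotation.lean`, towards the named fact
`Literature.Topology.FourManifolds.MMSW.eventually_approxHasRasmussen` (Manolescu–Marengon–
Sarkar–Willis, Duke Math. J. 172 (2023), arXiv:1910.08195, Thm. 1.4 / Prop. 8.2 (i)).

The tree's finite approximation `finiteApprox r k K = Φ₀ ∘ σ^k ∘ K` twists by the fibre rotation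
`σ^k = fibreRot (u^k)`, `u(z) = Π_j (z - c_j)/|z - c_j|`, whose rotation angle `k Σ_j arg(z - c_j)`
is spread over the whole planar domain; MMSW's `D(k⃗)` inserts `k` full twists where the strands
cross a membrane (the belt sphere / spanning disc of each dotted circle), i.e. twists by a fibre
rotation whose multiplier is `1` off thin membrane regions.  Here the two are joined:

* `MMSW.membranePhase r k c₁ c₂ z = -k Σ_j truncArg ½ c₁ c₂ (i (z - c_j)) + k r π/2` — a GLOBALLY
  smooth real function (`contDiff_membranePhase`): the truncated argument `truncArg` of the tree
  (`Literature/Analysis/SpecialFunctions/SmoothTruncatedArg.lean`) agrees with `arg` off a thin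
  wedge about the negative real axis and vanishes near it, and `i (z - c_j)` is negative real
  exactly on the upward ray from `c_j` — the membrane arc `γ_j = {c_j + i s}`, which avoids the
  other holes;
* `MMSW.membraneFamily r k c₁ c₂ a z = u(z)^k · exp(i a · membranePhase z)` — a smooth family of
  unit multipliers (`norm_membraneFamily`, `contDiffAt_membraneFamily`) from `u^k` at `a = 0`
  (`membraneFamily_zero`) to the **membrane multiplier** at `a = 1`, which is `1` off the wedges
  `{z : Re(i(z - c_j))/|z - c_j| < c₁}` about the rays `γ_j` (`membraneFamily_one_eq_one`:
  `u^k · Π_j e^{-ik arg(i(z - c_j))} · i^{kr} = 1`, as `e^{i arg β} = β/|β|`);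
* `MMSW.membraneTwist r k c₁ c₂ = fibreRot (membraneFamily r k c₁ c₂ 1)` — the **membrane twist**:
  the identity off the membrane wedges (`membraneTwist_eq_self`), and, by `MMSWFibreRotation`,
  joined to `σ^k` by a smooth isotopy of model knots through core-missing knots; hence
  **`s₋(membraneTwist ∘ K) = s₋(K)`** (`hasSMinus_membraneTwist_comp_iff`; MMSW Thm. 2.8 for the
  Dehn twists `σ_i`, in membrane form) and **the Rasmussen invariants of `D(k⃗ + j⃗)` of `K` are
  those of `D(j⃗)` of the membrane-twisted knot** (`approxHasRasmussen_iff_membraneTwist`) — so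
  the eventual value `s₋(K)` may be computed from pictures in which the twists sit at the
  membranes, as in MMSW's `D(k⃗)`.

The wedge parameters `-1 < c₂ < c₁` are free (`c₁ = -cos a` gives wedges of half-angle `a`; for
`a < 1/(20(r+1))` the `r` wedges are pairwise disjoint inside the planar domain `|z| ≤ 40(r+1)` and
meet no other guard disc).  Not done here: general position of model knots with respect to the
standard picture and the reading of the twisted Gauss diagram (the remaining geometric input of
the finite approximation theorem), nor the stabilisation of `s` itself (MMSW Thm. 3.3, via
Willis's finite approximation of the Khovanov complex).

## References

* C. Manolescu, M. Marengon, S. Sarkar, M. Willis, Duke Math. J. 172 (2023) 231–311,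
  arXiv:1910.08195: §2.1 (`D(k⃗)`: "insert `k` full twists in place of each handle"), §2.3 and
  Thm. 2.8 (the Dehn twist `σ_i` along the belt sphere), Prop. 8.2.
  [ManolescuMarengonSarkarWillis2023]
* M. W. Hirsch, *Differential Topology* (1976), Ch. 8 §1, Thm. 1.3 (isotopy extension).
  [HirschDT1976]
-/

open scoped Manifold ContDiff Topology ComplexConjugate Real
open Function Set Complex

noncomputable section

namespace Literature.Topology.FourManifolds

/-- Local notation: `𝔼 n` is the model Euclidean space `EuclideanSpace ℝ (Fin n)`. -/
local notation "𝔼 " n:arg => EuclideanSpace ℝ (Fin n)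

/-- Local notation: `𝕊 n` is the unit sphere in `EuclideanSpace ℝ (Fin (n + 1))`. -/
local notation "𝕊 " n:arg => (Metric.sphere (0 : EuclideanSpace ℝ (Fin (n + 1))) 1)

namespace MMSW

open Literature.AlgebraicTopology.Homotopy.HopfFibration (zC wC ofZW zC_ofZW wC_ofZW ofZW_zC_wC)
open Literature.Analysis.SpecialFunctions (truncArg contDiff_truncArg truncArg_eq_arg)

variable {r : ℕ}

/-! ## The membrane phase and the family of multipliers -/

/-- The rotated hole coordinate `β_j(z) = i (z - c_j)`: negative real exactly on the upward ray
`γ_j = {c_j + i s, s > 0}` from the `j`-th hole centre (the membrane arc). [folklore] -/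
def membraneCoord (r : ℕ) (j : Fin r) (z : ℂ) : ℂ :=
  I * (z - holeCentre r j)

/-- `|β_j(z)| = |z - c_j|`. [folklore] -/
@[simp] theorem norm_membraneCoord (j : Fin r) (z : ℂ) :
    ‖membraneCoord r j z‖ = ‖z - holeCentre r j‖ := by
  rw [membraneCoord, norm_mul, Complex.norm_I, one_mul]

/-- **The membrane phase** `-k Σ_j truncArg ½ c₁ c₂ (β_j z) + k r π/2`: a globally smooth real
function which, off the wedges about the membrane arcs, is `-k Σ_j arg(i(z - c_j)) + k r π/2`.
[folklore] -/
def membranePhase (r : ℕ) (k : ℤ) (c₁ c₂ : ℝ) (z : ℂ) : ℝ :=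
  -(k : ℝ) * ∑ j : Fin r, truncArg (1 / 2) c₁ c₂ (membraneCoord r j z) + (k : ℝ) * (r : ℝ) * (π / 2)

/-- **The membrane family of multipliers** `Φ_a(z) = u(z)^k · exp(i a · membranePhase z)`, from
`u^k` (`a = 0`) to the membrane multiplier (`a = 1`). [folklore] -/
def membraneFamily (r : ℕ) (k : ℤ) (c₁ c₂ : ℝ) (a : ℝ) (z : ℂ) : ℂ :=
  twistUnit r z ^ k * exp (((a * membranePhase r k c₁ c₂ z : ℝ) : ℂ) * I)

/-- **The membrane twist** `(z, w) ↦ (z, w · Φ₁(z))`: `k` full twists inserted across each membrane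
`γ_j × S¹`. [cite: ManolescuMarengonSarkarWillis2023, §2.1 and §2.3] -/
def membraneTwist (r : ℕ) (k : ℤ) (c₁ c₂ : ℝ) : 𝔼 4 → 𝔼 4 :=
  fibreRot (membraneFamily r k c₁ c₂ 1)

/-- At `a = 0` the membrane family is `u^k`. [folklore] -/
theorem membraneFamily_zero (r : ℕ) (k : ℤ) (c₁ c₂ : ℝ) :
    membraneFamily r k c₁ c₂ 0 = fun z ↦ twistUnit r z ^ k := by
  funext z
  simp [membraneFamily]

/-- The membrane multipliers are units away from the hole centres. [folklore] -/
theorem norm_membraneFamily {z : ℂ} (hz : ∀ j : Fin r, z ≠ holeCentre r j) (k : ℤ) (c₁ c₂ a : ℝ) :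
    ‖membraneFamily r k c₁ c₂ a z‖ = 1 := by
  rw [membraneFamily, norm_mul, norm_zpow, norm_twistUnit hz, one_zpow, one_mul,
    Complex.norm_exp_ofReal_mul_I]

/-- The membrane phase is smooth on all of `ℂ` (`-1 < c₂ < c₁`). [folklore] -/
theorem contDiff_membranePhase (r : ℕ) (k : ℤ) {c₁ c₂ : ℝ} (hc : c₂ < c₁) (hc₂ : -1 < c₂) :
    ContDiff ℝ ∞ (membranePhase r k c₁ c₂) := by
  have hT : ContDiff ℝ ∞ (truncArg (1 / 2) c₁ c₂) :=
    contDiff_truncArg (by norm_num) hc hc₂ (n := ⊤)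
  have hβ : ∀ j : Fin r, ContDiff ℝ ∞ (membraneCoord r j) := fun j ↦
    contDiff_const.mul (contDiff_id.sub contDiff_const)
  unfold membranePhase
  exact (contDiff_const.mul (ContDiff.sum fun j _ ↦ hT.comp (hβ j))).add contDiff_const

/-- **The membrane family is jointly smooth in `(a, z)`** at every `z` off the hole centres.
[folklore] -/
theorem contDiffAt_membraneFamily {z : ℂ} (hz : ∀ j : Fin r, z ≠ holeCentre r j) (k : ℤ)
    {c₁ c₂ : ℝ} (hc : c₂ < c₁) (hc₂ : -1 < c₂) (a : ℝ) :
    ContDiffAt ℝ ∞ (uncurry (membraneFamily r k c₁ c₂)) (a, z) := by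
  have hu : ContDiffAt ℝ ∞ (fun p : ℝ × ℂ ↦ twistUnit r p.2 ^ k) (a, z) :=
    (contDiffAt_zpow_complex (twistUnit_ne_zero hz) k).comp (a, z)
      ((contDiffAt_twistUnit hz).comp (a, z) contDiffAt_snd)
  have hph : ContDiffAt ℝ ∞ (fun p : ℝ × ℂ ↦ p.1 * membranePhase r k c₁ c₂ p.2) (a, z) :=
    contDiffAt_fst.mul ((contDiff_membranePhase r k hc hc₂).contDiffAt.comp (a, z) contDiffAt_snd)
  have hexp : ContDiffAt ℝ ∞
      (fun p : ℝ × ℂ ↦ exp (((p.1 * membranePhase r k c₁ c₂ p.2 : ℝ) : ℂ) * I)) (a, z) :=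
    (Complex.contDiff_exp.contDiffAt).comp (a, z)
      (((Complex.ofRealCLM.contDiff.contDiffAt).comp (a, z) hph).mul contDiffAt_const)
  exact hu.mul hexp

/-! ## The membrane multiplier is `1` off the wedges -/

/-- `e^{iπ/2} = i`. [folklore] -/
theorem exp_pi_div_two_mul_I' : exp (((π / 2 : ℝ) : ℂ) * I) = I := by
  apply Complex.ext
  · rw [Complex.exp_ofReal_mul_I_re, Real.cos_pi_div_two, Complex.I_re]
  · rw [Complex.exp_ofReal_mul_I_im, Real.sin_pi_div_two, Complex.I_im]

/-- `e^{i arg β_j(z)} = i (z - c_j)/|z - c_j|`. [folklore] -/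
theorem exp_arg_membraneCoord_mul_I {z : ℂ} (hz : ∀ j : Fin r, z ≠ holeCentre r j) (j : Fin r) :
    exp ((arg (membraneCoord r j z) : ℂ) * I) =
      I * ((z - holeCentre r j) / ((‖z - holeCentre r j‖ : ℝ) : ℂ)) := by
  have h := Complex.norm_mul_exp_arg_mul_I (membraneCoord r j z)
  rw [norm_membraneCoord] at h
  have hn : ((‖z - holeCentre r j‖ : ℝ) : ℂ) ≠ 0 := by
    exact_mod_cast norm_ne_zero_iff.2 (sub_ne_zero.2 (hz j))
  rw [mul_div_assoc', eq_div_iff hn, mul_comm]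
  rw [h, membraneCoord]

/-- **The membrane multiplier is `1` off the wedges**: if `z` keeps distance `≥ 1` from the hole
centres (the guard) and lies off every wedge, `Re β_j(z)/|β_j(z)| ≥ c₁` for all `j`, then
`Φ₁(z) = u(z)^k · Π_j e^{-ik arg β_j(z)} · i^{kr} = 1`. [folklore] -/
theorem membraneFamily_one_eq_one {z : ℂ} (hz : ∀ j : Fin r, (1 : ℝ) ≤ ‖z - holeCentre r j‖)
    (k : ℤ) {c₁ c₂ : ℝ} (hc : c₂ < c₁)
    (hoff : ∀ j : Fin r, c₁ ≤ (membraneCoord r j z).re / ‖membraneCoord r j z‖) :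
    membraneFamily r k c₁ c₂ 1 z = 1 := by
  have hz' : ∀ j : Fin r, z ≠ holeCentre r j := fun j h ↦ by
    have := hz j
    rw [h, sub_self, norm_zero] at this
    exact absurd this (by norm_num)
  -- off the wedges the truncated arguments are the arguments
  have hT : ∀ j : Fin r, truncArg (1 / 2) c₁ c₂ (membraneCoord r j z) = arg (membraneCoord r j z) :=
    fun j ↦ truncArg_eq_arg (by norm_num) hc
      (by rw [norm_membraneCoord]; linarith [hz j]) (hoff j)
  -- `exp (i Σ_j arg β_j) = i^r · u`
  have hsum : exp (((∑ j : Fin r, arg (membraneCoord r j z) : ℝ) : ℂ) * I) =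
      I ^ r * twistUnit r z := by
    rw [Complex.ofReal_sum, Finset.sum_mul, Complex.exp_sum]
    simp_rw [exp_arg_membraneCoord_mul_I hz']
    rw [Finset.prod_mul_distrib, Finset.prod_const, Finset.card_univ, Fintype.card_fin, twistUnit]
  -- the phase at `a = 1`
  have hphase : (((1 * membranePhase r k c₁ c₂ z : ℝ) : ℂ)) * I =
      ((-k : ℤ) : ℂ) * ((((∑ j : Fin r, arg (membraneCoord r j z) : ℝ) : ℂ)) * I) +
        ((k * r : ℤ) : ℂ) * ((((π / 2 : ℝ) : ℂ)) * I) := by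
    simp only [membranePhase, hT, one_mul]
    push_cast
    ring
  have hu : twistUnit r z ≠ 0 := twistUnit_ne_zero hz'
  rw [membraneFamily, hphase, Complex.exp_add, Complex.exp_int_mul, Complex.exp_int_mul, hsum,
    exp_pi_div_two_mul_I', mul_zpow, ← zpow_natCast, ← zpow_mul]
  -- `u^k * (I^(r * -k) * u^(-k) * I^(k * r)) = 1`
  have h1 : twistUnit r z ^ k * twistUnit r z ^ (-k) = 1 := by
    rw [← zpow_add₀ hu, add_neg_cancel, zpow_zero]
  have h2 : I ^ ((r : ℤ) * -k) * I ^ (k * r) = 1 := by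
    rw [← zpow_add₀ I_ne_zero, show (r : ℤ) * -k + k * r = 0 by ring, zpow_zero]
  calc twistUnit r z ^ k * (I ^ ((r : ℤ) * -k) * twistUnit r z ^ (-k) * I ^ (k * r))
      = (twistUnit r z ^ k * twistUnit r z ^ (-k)) * (I ^ ((r : ℤ) * -k) * I ^ (k * r)) := by
        ring
    _ = 1 := by rw [h1, h2, one_mul]

/-- **The membrane twist is the identity off the membrane wedges** (on the guard region).
[cite: ManolescuMarengonSarkarWillis2023, §2.1] -/
theorem membraneTwist_eq_self {x : 𝔼 4} (hx : ∀ j : Fin r, (1 : ℝ) ≤ holeTerm r j x) (k : ℤ)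
    {c₁ c₂ : ℝ} (hc : c₂ < c₁)
    (hoff : ∀ j : Fin r, c₁ ≤ (membraneCoord r j (zC x)).re / ‖membraneCoord r j (zC x)‖) :
    membraneTwist r k c₁ c₂ x = x := by
  refine fibreRot_of_apply_eq_one (membraneFamily_one_eq_one (fun j ↦ ?_) k hc hoff)
  have h := hx j
  rw [holeTerm_eq_normSq, Complex.normSq_eq_norm_sq] at h
  nlinarith [norm_nonneg (zC x - holeCentre r j)]

/-! ## The membrane twist versus the sphere twist on model knots -/

/-- **`s₋` is invariant under the membrane twist** (MMSW Thm. 2.8 for the Dehn twists along the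
belt spheres, in membrane form): for any model knot `K ⊂ M_r`, `s₋(membraneTwist ∘ K) = s ↔
s₋(K) = s` — the membrane family is a smooth isotopy of model knots from `σ^k ∘ K`
(`isSmoothModelIsotopy_fibreRot`, `MMSWFibreRotation`), and `s₋` is invariant under `σ^k`
(`hasSMinus_sphereTwist_comp_iff`) and under isotopy. [cite: ManolescuMarengonSarkarWillis2023, Thm. 2.8] -/
theorem hasSMinus_membraneTwist_comp_iff {K : 𝕊 1 → 𝔼 4} (hK : IsModelKnot r K) (k : ℤ)
    {c₁ c₂ : ℝ} (hc : c₂ < c₁) (hc₂ : -1 < c₂) (s : ℤ) :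
    HasSMinus r (membraneTwist r k c₁ c₂ ∘ K) s ↔ HasSMinus r K s := by
  have hz : ∀ t, ∀ j : Fin r, zC (K t) ≠ holeCentre r j := fun t ↦ zC_ne_holeCentre (hK.mem t).1
  have h := hasSMinus_fibreRot_iff_of_family hK (Φ := membraneFamily r k c₁ c₂)
    (fun a t ↦ contDiffAt_membraneFamily (hz t) k hc hc₂ a)
    (fun a t ↦ norm_membraneFamily (hz t) k c₁ c₂ a) s
  rw [membraneFamily_zero, ← sphereTwist_eq_fibreRot, hasSMinus_sphereTwist_comp_iff] at h
  exact h.symm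

/-- **`s₊` is invariant under the membrane twist.** [cite: ManolescuMarengonSarkarWillis2023, Thm. 2.8] -/
theorem hasSPlus_membraneTwist_comp_iff {K : 𝕊 1 → 𝔼 4} (hK : IsModelKnot r K) (k : ℤ)
    {c₁ c₂ : ℝ} (hc : c₂ < c₁) (hc₂ : -1 < c₂) (s : ℤ) :
    HasSPlus r (membraneTwist r k c₁ c₂ ∘ K) s ↔ HasSPlus r K s := by
  have hz : ∀ t, ∀ j : Fin r, zC (K t) ≠ holeCentre r j := fun t ↦ zC_ne_holeCentre (hK.mem t).1
  have hiso := (isSmoothModelIsotopy_fibreRot hK (Φ := membraneFamily r k c₁ c₂)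
    (fun a t ↦ contDiffAt_membraneFamily (hz t) k hc hc₂ a)
    (fun a t ↦ norm_membraneFamily (hz t) k c₁ c₂ a)).isModelIsotopic
  rw [membraneFamily_zero, ← sphereTwist_eq_fibreRot] at hiso
  rw [membraneTwist, ← hiso.hasSPlus_iff s, hasSPlus_sphereTwist_comp_iff]

/-- **The finite approximations of `K` versus pictures twisted at the membranes.**  For a model
knot `K ⊂ M_r` missing the cores, the Rasmussen invariants of `D(k⃗ + j⃗)` of `K` are those of
`D(j⃗)` of the membrane-twisted knot `membraneTwist r k c₁ c₂ ∘ K` — in particular (`j = 0`)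
`s(finiteApprox r k K)` is `s` of the untwisted standard picture of the knot obtained from `K` by
`k` full twists across each membrane, MMSW's `D(k⃗)`: the membrane family is an isotopy through
core-missing model knots from `σ^k ∘ K`, carried to an ambient isotopy of `S³`
(`approxHasRasmussen_iff_fibreRot_of_family`). [cite: ManolescuMarengonSarkarWillis2023, §2.1 and Prop. 8.2 (i)] -/
theorem approxHasRasmussen_iff_membraneTwist {K : 𝕊 1 → 𝔼 4} (hK : IsModelKnot r K)
    (hw : ∀ t, wC (K t) ≠ 0) (k : ℤ) {c₁ c₂ : ℝ} (hc : c₂ < c₁) (hc₂ : -1 < c₂) (j : ℤ) (s : ℤ) :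
    ApproxHasRasmussen r (k + j) K s ↔
      ApproxHasRasmussen r j (membraneTwist r k c₁ c₂ ∘ K) s := by
  have hz : ∀ t, ∀ j : Fin r, zC (K t) ≠ holeCentre r j := fun t ↦ zC_ne_holeCentre (hK.mem t).1
  exact approxHasRasmussen_iff_fibreRot_of_family hK hw (Φ := membraneFamily r k c₁ c₂)
    (fun a t ↦ contDiffAt_membraneFamily (hz t) k hc hc₂ a)
    (fun a t ↦ norm_membraneFamily (hz t) k c₁ c₂ a) (membraneFamily_zero r k c₁ c₂) j s

/-- **The eventual value through membrane pictures**: `s₋(K) = s` for a core-missing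
null-homologous model knot `K` as soon as the untwisted pictures `D(0⃗)` of the membrane-twisted
knots `membraneTwist r k c₁ c₂ ∘ K` have Rasmussen invariant `s` for all large `k` — the form of
the definition matching MMSW's `s₋(L) = s(D(k⃗))`, `k ≫ 0`, with the twists at the membranes.
[cite: ManolescuMarengonSarkarWillis2023, Def. 8.1 and Prop. 8.2 (i)] -/
theorem hasSMinus_of_eventually_membraneTwist {K : 𝕊 1 → 𝔼 4} (hK : IsModelKnot r K)
    (h0 : IsNullHomologous r K) (hw : ∀ t, wC (K t) ≠ 0) {c₁ c₂ : ℝ} (hc : c₂ < c₁)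
    (hc₂ : -1 < c₂) {s k₀ : ℤ}
    (h : ∀ k, k₀ ≤ k → ApproxHasRasmussen r 0 (membraneTwist r k c₁ c₂ ∘ K) s) :
    HasSMinus r K s := by
  refine ⟨h0, K, IsModelIsotopic.refl hK, hw, k₀, fun k hk ↦ ?_⟩
  have h' := h k hk
  rwa [← approxHasRasmussen_iff_membraneTwist hK hw k hc hc₂ 0 s, add_zero] at h'

/-- **`eventually_approxHasRasmussen` for knots off the membranes.**  If the planar shadow
`z ∘ K` of a core-missing model knot stays off every membrane wedge
(`Re β_j/|β_j| ≥ c₁` for all `j`, `β_j(z) = i(z - c_j)`; e.g. a knot lying below the row of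
holes, or inside a ball meeting no belt sphere), then the membrane twists fix `K` pointwise, all
its standard pictures `D(k⃗)`, `k ∈ ℤ`, have the same Rasmussen invariant as `D(0⃗)`, and the
eventual-constancy statement of `MMSW.eventually_approxHasRasmussen` holds for `K` from any `k₀`
on: such knots do not run over the `1`-handles, and for them `s₋ = s₊ = s(D(0⃗))` as for local
knots (MMSW, Ex. 8.3). [cite: ManolescuMarengonSarkarWillis2023, Ex. 8.3 and Prop. 8.2 (i)] -/
theorem exists_forall_approxHasRasmussen_of_offWedge {K : 𝕊 1 → 𝔼 4} (hK : IsModelKnot r K)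
    (hw : ∀ t, wC (K t) ≠ 0) {c₁ c₂ : ℝ} (hc : c₂ < c₁) (hc₂ : -1 < c₂)
    (hoff : ∀ t, ∀ j : Fin r,
      c₁ ≤ (membraneCoord r j (zC (K t))).re / ‖membraneCoord r j (zC (K t))‖) :
    ∃ s : ℤ, ∀ k : ℤ, ApproxHasRasmussen r k K s := by
  obtain ⟨s, hs⟩ := hK.exists_approxHasRasmussen hw 0
  refine ⟨s, fun k ↦ ?_⟩
  have hfix : membraneTwist r k c₁ c₂ ∘ K = K :=
    funext fun t ↦ membraneTwist_eq_self (hK.mem t).1 k hc (hoff t)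
  have h := approxHasRasmussen_iff_membraneTwist hK hw k hc hc₂ 0 s
  rw [add_zero, hfix] at h
  exact h.2 hs

/-- The same, bundled with null-homology into the two invariants: **a core-missing
null-homologous model knot off the membranes has `s₋(K) = s₊(K) = s(D(0⃗))`** — `s₋` from
`exists_forall_approxHasRasmussen_of_offWedge`, `s₊` likewise for the mirror `ρ ∘ K`, which is
again off the (mirror-symmetric) membranes. [cite: ManolescuMarengonSarkarWillis2023, Ex. 8.3] -/
theorem exists_hasSMinus_of_offWedge {K : 𝕊 1 → 𝔼 4} (hK : IsModelKnot r K)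
    (h0 : IsNullHomologous r K) (hw : ∀ t, wC (K t) ≠ 0) {c₁ c₂ : ℝ} (hc : c₂ < c₁)
    (hc₂ : -1 < c₂)
    (hoff : ∀ t, ∀ j : Fin r,
      c₁ ≤ (membraneCoord r j (zC (K t))).re / ‖membraneCoord r j (zC (K t))‖) :
    ∃ s, HasSMinus r K s := by
  obtain ⟨s, hs⟩ := exists_forall_approxHasRasmussen_of_offWedge hK hw hc hc₂ hoff
  exact ⟨s, h0, K, IsModelIsotopic.refl hK, hw, 0, fun k _ ↦ hs k⟩

/-- Points in the closed lower half `Im z ≤ 0` of the planar domain are off every membrane wedge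
as soon as `c₁ ≤ 0`: there `Re β_j(z) = -Im z ≥ 0`. [folklore] -/
theorem le_re_membraneCoord_div_norm_of_im_nonpos {z : ℂ} (hz : z.im ≤ 0) {c₁ : ℝ} (hc₁ : c₁ ≤ 0)
    (j : Fin r) : c₁ ≤ (membraneCoord r j z).re / ‖membraneCoord r j z‖ := by
  have hre : 0 ≤ (membraneCoord r j z).re := by
    rw [membraneCoord, holeCentre]
    simp only [Complex.mul_re, Complex.I_re, Complex.sub_re, zero_mul, Complex.I_im,
      Complex.sub_im, Complex.ofReal_im, sub_zero, one_mul, zero_sub]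
    linarith
  exact hc₁.trans (div_nonneg hre (norm_nonneg _))

/-- **Knots below the row of holes have `k`-independent pictures**: a core-missing model knot
whose planar shadow lies in the closed lower half-plane `Im z ≤ 0` satisfies the conclusion of
`MMSW.eventually_approxHasRasmussen` for every `k₀` (take the wedges `c₁ = -cos 1 < 0`,
`c₂ = -cos (1/2)`). [cite: ManolescuMarengonSarkarWillis2023, Ex. 8.3 and Prop. 8.2 (i)] -/
theorem exists_forall_approxHasRasmussen_of_im_nonpos {K : 𝕊 1 → 𝔼 4} (hK : IsModelKnot r K)
    (hw : ∀ t, wC (K t) ≠ 0) (him : ∀ t, (zC (K t)).im ≤ 0) :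
    ∃ s : ℤ, ∀ k : ℤ, ApproxHasRasmussen r k K s := by
  have h1 : -Real.cos (1 / 2) < -Real.cos 1 := by
    have := Real.cos_lt_cos_of_nonneg_of_le_pi_div_two (by norm_num : (0 : ℝ) ≤ 1 / 2)
      (by linarith [Real.pi_gt_three] : (1 : ℝ) ≤ Real.pi / 2) (by norm_num : (1 : ℝ) / 2 < 1)
    linarith
  have h2 : (-1 : ℝ) < -Real.cos (1 / 2) := by
    have : Real.cos (1 / 2) < Real.cos 0 :=
      Real.cos_lt_cos_of_nonneg_of_le_pi_div_two le_rfl (by linarith [Real.pi_gt_three])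
        (by norm_num)
    rw [Real.cos_zero] at this
    linarith
  have hc₁ : -Real.cos 1 ≤ 0 := by
    have : 0 ≤ Real.cos 1 := Real.cos_nonneg_of_mem_Icc ⟨by linarith [Real.pi_gt_three],
      by linarith [Real.pi_gt_three]⟩
    linarith
  exact exists_forall_approxHasRasmussen_of_offWedge hK hw h1 h2 fun t j ↦
    le_re_membraneCoord_div_norm_of_im_nonpos (him t) hc₁ j

end MMSW

end Literature.Topology.FourManifolds

end
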